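import Mathlib
import Summits.CriticalPhenomena.Ising3DConformalLimit.Theses.HyperoctahedralRP

/-!
# Sketch — crux-ideate stmt-CriticalPhenomena-1979 (HRP2Rigidity), ideator k=2

First-lemma signatures of the two idea cards (they need not be proved here; they must elaborate).

* Card A `laplace-lightcone-bootstrap`:
  - `laplaceDomain_convex`  — Hölder convexity of the domain of convergence of the real Laplace transform of a
    finite positive measure on `ℝ³` (Cuppens 1975, Thm 3.3.1: the tool that convexifies pole-door clear heights);
  - `diamondLemma` — the first crux-specific checkable statement of the line: under the hypotheses of
    `HRP2Rigidity`, for every `t > 0` the transverse function `q ↦ K (t e₃ + q)` on `e₃^⊥ ≅ ℝ²` has a power series at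
    `0` converging on the ball of radius `t/√2` (= the in-radius of the "diamond" `|y₁|+|y₂| < t` obtained from the
    two-pole lemma spokes `±e₁, ±e₂` by convexity; round kernel: radius `t`).
* Card B `projective-algebraization`:
  - `quarticPolarLocusIncompatible` — degree-4 instance of the polar-locus root test (first crux-specific lemma);
  - `karamataPinning` — the Hardy–Littlewood–Karamata Tauberian statement used to pin the germ of the
    Källén–Lehmann measure at the light cone from the universal `(z·z)^{-Δ}` blow-up of `K` at the complex null cone.
-/

namespace Summit.CriticalPhenomena.Ising3DConformalLimit.Cruxes.HRP2Rigidity.Sketch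

open MeasureTheory

/-- Card A, tool: the set of `v` at which the real Laplace transform of a finite positive measure converges is
convex (Hölder). Cuppens 1975 Thm 3.3.1 / 3.3.2. -/
theorem laplaceDomain_convex (μ : Measure (EuclideanSpace ℝ (Fin 3))) [IsFiniteMeasure μ] :
    Convex ℝ {v : EuclideanSpace ℝ (Fin 3) |
      Integrable (fun m : EuclideanSpace ℝ (Fin 3) => Real.exp (-(inner ℝ v m))) μ} := by
  sorry

/-- Card A, first crux-specific lemma ("diamond lemma"): nine-mirror RP + homogeneity (exactly the hypotheses of
`HRP2Rigidity`) ⟹ the transverse restriction of `K` at height `t` along `e₃` is real-analytic at `0` with radius of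
convergence at least `t/√2`.  Chain: two-pole lemma (pole doors of `e₃` toward `±e₁, ±e₂` clear to all heights)
⟹ exponential moments of the transverse spectral measure along `±e₁, ±e₂` up to `t` (Lévy–Raikov / Cuppens 3.3.1)
⟹ convergence on the diamond `|y₁|+|y₂|<t` (convexity) ⟹ holomorphy on the tube over it ⟹ power series on
`{|q₁|+|q₂|<t} ⊃ B(0,t/√2)`. -/
theorem diamondLemma :
    ∀ (Δ : ℝ) (K : EuclideanSpace ℝ (Fin 3) → ℝ), 1/2 ≤ Δ → Δ ≤ 1 → ContinuousOn K {0}ᶜ →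
      (∀ x, x ≠ 0 → 0 < K x) → (∀ c : ℝ, 0 < c → ∀ x, K (c • x) = c ^ (-(2 * Δ)) * K x) →
      (∀ n : EuclideanSpace ℝ (Fin 3), (∃ i j : Fin 3, i ≠ j ∧ (n = EuclideanSpace.single i 1 ∨
          n = EuclideanSpace.single i 1 + EuclideanSpace.single j 1 ∨
          n = EuclideanSpace.single i 1 - EuclideanSpace.single j 1)) →
        (∀ x, K (((ℝ ∙ n)ᗮ).reflection x) = K x) ∧
        (∀ (m : ℕ) (p : Fin m → EuclideanSpace ℝ (Fin 3)) (c : Fin m → ℝ), (∀ a, 0 < inner ℝ (p a) n) →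
          0 ≤ ∑ a, ∑ b, c a * c b * K (p a - ((ℝ ∙ n)ᗮ).reflection (p b)))) →
      ∀ t : ℝ, 0 < t →
        ∃ pser : FormalMultilinearSeries ℝ (EuclideanSpace ℝ (Fin 2)) ℝ,
          HasFPowerSeriesOnBall
            (fun q : EuclideanSpace ℝ (Fin 2) =>
              K (t • EuclideanSpace.single 2 1 + (EuclideanSpace.single 0 (q 0) + EuclideanSpace.single 1 (q 1))))
            pser 0 (ENNReal.ofReal (t / Real.sqrt 2)) := by
  sorry

/-- Card B, tool: Karamata's Tauberian theorem for Laplace–Stieltjes transforms of positive measures on `[0,∞)`: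
`t^ρ ∫ e^{-tx} dμ(x) → C` as `t → 0⁺` implies `μ[0,x] / x^ρ → C / Γ(ρ+1)` as `x → ∞`. -/
theorem karamataPinning (μ : Measure ℝ) [IsLocallyFiniteMeasure μ] (hsupp : μ (Set.Iio 0) = 0)
    (ρ C : ℝ) (hρ : 0 < ρ) (hC : 0 ≤ C)
    (hfin : ∀ t : ℝ, 0 < t → Integrable (fun x : ℝ => Real.exp (-(t * x))) μ)
    (h : Filter.Tendsto (fun t : ℝ => t ^ ρ * ∫ x, Real.exp (-(t * x)) ∂μ)
      (nhdsWithin 0 (Set.Ioi 0)) (nhds C)) :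
    Filter.Tendsto (fun x : ℝ => (μ (Set.Icc 0 x)).toReal / x ^ ρ) Filter.atTop
      (nhds (C / Real.Gamma (ρ + 1))) := by
  sorry


/-- Card B, first crux-specific lemma (degree-4 case of the "nine root tests for the POLAR locus"): for every
real `c ≠ 0` the `O_h`-invariant quartic cone `P_c = (z·z)² + c Σ zᵢ⁴` either has a nonzero REAL zero (so it cannot
be the singular locus of a kernel that is real-analytic on `ℝ³∖0`), or on a leaf of the `e₃`-book or of the
`(e₁+e₂)/√2`-book it has a root `[α:β]` off `ℝ ∪ iℝ`, i.e. a singular point that is neither real nor on a door —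
forbidden for a nine-RP kernel (refuters' root test, here applied to poles instead of zeros). Non-perturbative in `c`
(compare `NullConeLocalRigidity`, which is the `ε → 0` version for zero loci). -/
theorem quarticPolarLocusIncompatible :
    ∀ c : ℝ, c ≠ 0 →
      (∃ x : Fin 3 → ℝ, x ≠ 0 ∧ (∑ i, x i ^ 2) ^ 2 + c * ∑ i, x i ^ 4 = 0) ∨
      (∃ (n m : Fin 3 → ℝ) (α β : ℂ),
        (n = ![0, 0, 1] ∨ n = ![Real.sqrt 2 / 2, Real.sqrt 2 / 2, 0]) ∧ (∑ i, n i * m i) = 0 ∧ m ≠ 0 ∧ β ≠ 0 ∧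
        ((∑ i, (α * (n i : ℂ) + β * (m i : ℂ)) ^ 2) ^ 2
            + (c : ℂ) * ∑ i, (α * (n i : ℂ) + β * (m i : ℂ)) ^ 4 = 0) ∧
        (α / β).re ≠ 0 ∧ (α / β).im ≠ 0) := by
  sorry

/-- Sanity: the crux decl this sketch serves is in scope. -/
example : Prop := Summit.CriticalPhenomena.Ising3DConformalLimit.Theses.HyperoctahedralRP.HRP2Rigidity

end Summit.CriticalPhenomena.Ising3DConformalLimit.Cruxes.HRP2Rigidity.Sketch
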